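import Literature.MathematicalPhysics.QuantumLattice.GrassmannWeightedEffectiveActionBound
import Literature.MathematicalPhysics.QuantumLattice.GrassmannWeightedKernelYoung
import Literature.MathematicalPhysics.QuantumLattice.GrassmannEffectiveActionRepresentation
import HarnessLib

/-!
# The decay-weighted single-scale step read in another representation of the fields

Topic `MathematicalPhysics/QuantumLattice`; the WEIGHTED form of `GrassmannEffectiveActionRepresentation.lean`
(Benfatto–Giuliani–Mastropietro 2006, §2.5–2.8 with the decay bookkeeping of §3 (3.2)–(3.8)).  The interaction of the
physical fields is `V = map f Ṽ` for an even polynomial `Ṽ` of auxiliary fields (labels `Γ'`, e.g. position-space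
sector fields, sitting at positions `π' : Γ' → Λ`), the Gaussian integration runs on the auxiliary fields with the
pulled-back covariance `C' = Mᵀ C M`, and the output is read through an analysis map `g` (labels `Γ''` at positions
`π'' : Γ'' → Λ`).  For a tree weight `wt` on `Finset Λ` (e.g. `(1 + γ^h diam)^N`): if the kernels of `Ṽ` have
`wt`-weighted pinned `L¹` norms `N(m')`, the entries of `C'` have row and column sums `≤ α` against the pair weights
`wt{π' X, π' Y}`, and the entries of `E M` (`E = toMatrix' g`) have row / column sums `≤ cr / cc` against
`wt{π'' X'', π' X'}`, then with `θ = eα‖Ṽ‖_h/κ² < 1` the normalised partition function is a unit and, in every degree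
`m + 1`, one output leg pinned and the output POSITIONS weighted,

`Σ_{X'' : X''_p = w''} wt(π'' X'') ‖kernel (map g (effAction C V)) (m+1) X''‖ ≤ cr · cc^m · ρ^{-(m+1)} · e‖Ṽ‖_h / (1 - θ)`

(`sum_wt_norm_kernel_map_effAction_le`): the weighted engine (`sum_wt_norm_kernel_effAction_le`, weight pulled back to
`Γ'` along `π'`) followed by the weighted Young inequality (`sum_filter_wt_norm_kernel_map_le`).

Everything is proved; no definitions, no named facts.

## Sources

G. Benfatto, A. Giuliani, V. Mastropietro, Ann. Henri Poincaré 7 (2006) 809–898, §2.7 (2.66)–(2.73), §2.8 (2.76)–(2.83),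
§3 (3.2)–(3.8) [`BenfattoGiulianiMastropietro2006`]; M. Salmhofer, Commun. Math. Phys. 194 (1998) 249–295, §4.1
[`Salmhofer1998`].
-/

noncomputable section

namespace Literature.MathematicalPhysics.QuantumLattice

open GrassmannAlgebra Finset Literature.Probability.LatticeModels Literature.Probability.LatticeModels.BattleFederbush
open scoped InnerProductSpace

variable {𝕜 : Type*} [RCLike 𝕜] {Γ Γ' Γ'' Λ : Type*} [Fintype Γ] [DecidableEq Γ] [Fintype Γ'] [DecidableEq Γ']
  [Fintype Γ''] [DecidableEq Γ''] [DecidableEq Λ] {wt : Finset Λ → ℝ}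

/-- **The decay-weighted single-scale step read in another representation of the fields** (BGM 2006, (2.77) with
(2.71a), (2.80)–(2.82) and §3).  Let `V = map f Ṽ` with `Ṽ` EVEN without constant part on the auxiliary labels `Γ'`
(positions `π'`), `C' = Mᵀ C M` charged (`q`), in Gram form on the mixed pairs with constant `κ`, with row and column
sums of `‖C'(X,Y)‖ wt{π' X, π' Y}` at most `α`; let the kernels of `Ṽ` have `wt`-weighted pinned sums `≤ N(m')`, `ρ > 0`,
`θ = eα‖Ṽ‖_h/κ² < 1` with `‖Ṽ‖_h = normV Γ' κ ρ N`; and let `E M` (`E = toMatrix' g`, output positions `π''`) have row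
sums of `‖(E M)(X'',X')‖ wt{π'' X'', π' X'}` at most `cr` and column sums at most `cc`.  THEN `∫ dμ_C e^{-V}` is a unit and
in every degree `m + 1`, one output leg pinned,
`Σ_{X'' : X''_p = w''} wt(π'' X'') ‖kernel (map g (effAction C V)) (m+1) X''‖ ≤ cr · cc^m · ρ^{-(m+1)} · e‖Ṽ‖_h / (1 - θ)`.
[cite: BenfattoGiulianiMastropietro2006, (2.77) with (2.71a), (2.80)-(2.82) and §3 (3.2)-(3.8)] -/
theorem sum_wt_norm_kernel_map_effAction_le {E : Type*} [NormedAddCommGroup E] [InnerProductSpace 𝕜 E] (hwt : IsTreeWeight wt)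
    (π' : Γ' → Λ) (π'' : Γ'' → Λ)
    (C : Matrix Γ Γ 𝕜) (f : (Γ' → 𝕜) →ₗ[𝕜] (Γ → 𝕜)) (g : (Γ → 𝕜) →ₗ[𝕜] (Γ'' → 𝕜))
    (Vt : GrassmannAlgebra 𝕜 Γ') (hVt : Vt ∈ evenPart 𝕜 Γ') (hVt0 : constPart 𝕜 Vt = 0)
    (q : Γ' → Bool)
    (hC : ∀ X Y, q X = q Y → ((LinearMap.toMatrix' f).transpose * C * LinearMap.toMatrix' f) X Y = 0)
    (fv gv : Γ' → E) {κ : ℝ} (hκ : 0 < κ) (hf : ∀ X, q X = true → ‖fv X‖ ≤ κ) (hg : ∀ Y, q Y = false → ‖gv Y‖ ≤ κ)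
    (hGram : ∀ X Y, q X = true → q Y = false →
      contr 𝕜 ((LinearMap.toMatrix' f).transpose * C * LinearMap.toMatrix' f) X Y = ⟪fv X, gv Y⟫_𝕜)
    (N : ℕ → ℝ) (hN0 : ∀ m', 0 ≤ N m')
    (hN : ∀ m' (j : Fin (2 * m')) (w : Γ'), ∑ Y ∈ univ.filter (fun Y : Fin (2 * m') → Γ' => Y j = w),
      ‖kernel 𝕜 Vt (2 * m') Y‖ * wt ((univ.image Y).image π') ≤ N m')
    {α : ℝ} (hα : 0 < α)
    (hrow : ∀ X, ∑ Y, ‖((LinearMap.toMatrix' f).transpose * C * LinearMap.toMatrix' f) X Y‖ * wt {π' X, π' Y} ≤ α)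
    (hcol : ∀ Y, ∑ X, ‖((LinearMap.toMatrix' f).transpose * C * LinearMap.toMatrix' f) X Y‖ * wt {π' X, π' Y} ≤ α)
    {ρ : ℝ} (hρ : 0 < ρ) (hθ : Real.exp 1 * α * normV Γ' κ ρ N / κ ^ 2 < 1)
    {cr cc : ℝ} (hcc0 : 0 ≤ cc)
    (hrow' : ∀ X'', ∑ X', ‖(LinearMap.toMatrix' g * LinearMap.toMatrix' f) X'' X'‖ * wt {π'' X'', π' X'} ≤ cr)
    (hcol' : ∀ X', ∑ X'', ‖(LinearMap.toMatrix' g * LinearMap.toMatrix' f) X'' X'‖ * wt {π'' X'', π' X'} ≤ cc) :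
    IsUnit (effPartitionFn 𝕜 C (ExteriorAlgebra.map f Vt)) ∧ ∀ (m : ℕ) (p : Fin (m + 1)) (w'' : Γ''),
      ∑ X'' ∈ univ.filter (fun X'' : Fin (m + 1) → Γ'' => X'' p = w''), wt ((univ.image X'').image π'') *
          ‖kernel 𝕜 (ExteriorAlgebra.map g (effAction 𝕜 C (ExteriorAlgebra.map f Vt))) (m + 1) X''‖ ≤
        cr * cc ^ m * (ρ⁻¹ ^ (m + 1) * (Real.exp 1 * normV Γ' κ ρ N) / (1 - Real.exp 1 * α * normV Γ' κ ρ N / κ ^ 2)) := by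
  set C' : Matrix Γ' Γ' 𝕜 := (LinearMap.toMatrix' f).transpose * C * LinearMap.toMatrix' f with hC'
  -- the weight pulled back to the auxiliary labels
  have hwt' : IsTreeWeight (fun S : Finset Γ' => wt (S.image π')) := hwt.comap π'
  have hpair : ∀ X Y : Γ', (fun S : Finset Γ' => wt (S.image π')) {X, Y} = wt {π' X, π' Y} := fun X Y => by
    simp only [image_insert, image_singleton]
  -- the weighted single-scale step in the auxiliary representation
  obtain ⟨hunit, hbd⟩ := sum_wt_norm_kernel_effAction_le C' hwt' q hC fv gv hκ hf hg hGram Vt hVt hVt0 N hN0 hN hα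
    (fun X => by simp only [hpair]; exact hrow X) (fun Y => by simp only [hpair]; exact hcol Y) hρ hθ
  refine ⟨by rwa [effPartitionFn_map], fun m p w'' => ?_⟩
  have hB0 : 0 ≤ ρ⁻¹ ^ (m + 1) * (Real.exp 1 * normV Γ' κ ρ N) / (1 - Real.exp 1 * α * normV Γ' κ ρ N / κ ^ 2) := by
    have h0 : 0 ≤ normV Γ' κ ρ N := normV_nonneg hκ.le hρ.le hN0
    have h1 : 0 < 1 - Real.exp 1 * α * normV Γ' κ ρ N / κ ^ 2 := sub_pos.2 hθ
    positivity
  -- the output read through `g`: kernels of `map (g ∘ f) (effAction C' Ṽ)`, weighted Young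
  rw [effAction_map, map_map_eq_map_comp]
  exact sum_filter_wt_norm_kernel_map_le hwt π' π'' (g ∘ₗ f) hcc0
    (by intro X''; rw [LinearMap.toMatrix'_comp]; exact hrow' X'')
    (by intro X'; simp only [LinearMap.toMatrix'_comp]; exact hcol' X') (effAction 𝕜 C' Vt) m hB0
    (fun q' x => (le_of_eq (sum_congr rfl fun X _ => mul_comm _ _)).trans (hbd (Nat.succ_pos m) q' x)) p w''

end Literature.MathematicalPhysics.QuantumLattice
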